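import Summits.BirchSwinnertonDyer.BirchSwinnertonDyer.Theorems.GenusKolyvaginAtTwoMinimalTwinBSDTwoKrizLiAnchorWall
import HarnessLib

/-!
# Route `GenusKolyvaginAtTwo`, crux U₂ `MinimalTwinBSDTwo` (stmt-BirchSwinnertonDyer-22985), LINE 23 «twin_swap»: THE KRIZ–LI ANCHOR ROAD KEYED ON THE
# ADDITIVE WALL ROW ALONE — for a rank-one (★)-anchor `V` that is ADDITIVE and potentially good at `2` (`Addv V 2`, `0 ≤ ord₂ j`) with `N(V) < 5000` and a
# Heegner field with `d_K ≡ 1 (mod 4)`, the companion `V^{(d_K)}` is again additive at `2` (unramified twist), so `BSD(·, 2)` on the whole packet needs only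
# the ADDITIVE rank-zero wall row (item 19098 `AdditiveRankZeroAtTwo` of route ByReductionTypeAtTwo, displayed unfolded) + PRINT (incl. the ARS Manin input
# the anchor's local clause needs at an additive `2`)

Seat `bsd-line-gk2-p2` g34 (PROVER 2/3, cell `bsd-f1-sign2`; LINE 23 holder), `--supports stmt-BirchSwinnertonDyer-22985` (helper; closes nothing).
THEOREMS ONLY (0 `def`, 0 `sorry`); standard axioms; route-independent.  HONEST FRAMING (D-0014/D-0036): the additive twin of `…KrizLiAnchorWallSS.lean` (this
seat); the transport `Addv V 2 → Addv W 2` for twists by `d ≡ 1 (mod 4)` with `0 ≤ ord₂ j` is the K4 seat's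
`AddPotGoodPrint.addv_two_of_smul_quadraticTwist_of_emod_four_eq_one` (cell `bsd-2adic`, file `…PrintZhaiIrreducibleUnramified.lean`).  §1 ★
`krizLi_bsdp_two_of_twist_of_conductor_lt_of_addWall`; §2 the U₂-keyed sorting `rankOneMembers_of_addWall` / `rankZeroCompanions_of_addWall`.  Instances:
`…KrizLiAnchor148a1/172a1.lean` (Kriz–Li Table 1 rows `148a1 | −7 | 3 | ✓`, `172a1 | −7 | 3 | ✓`, Kodaira `IV*` at `2`).  **BSD is NOT proved by any of this; U₂ is
NOT proved; the additive wall (19098) is OPEN; no item is closed.**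

References: [KrizLi2019] Thm 5.1 (2), Thm 4.3, §6 Ex. 6.2, Table 1; [CreutzMiller2012] Thm 1.1; [AgasheRibetStein2006] Thm. 2.6; [SilvermanAEC2009] VII.5, X.5.
-/

set_option autoImplicit false
-- the Theorems namespace of this sub repeats the summit name by design (D-0017 nested layout)
set_option linter.dupNamespace false

noncomputable section

open scoped Classical

open WeierstrassCurve NumberField Literature.NumberTheory.EllipticCurves
  Literature.NumberTheory.EllipticCurves.ModularForms
  Literature.NumberTheory.EllipticCurves.Rank1Residual
  Literature.NumberTheory.EllipticCurves.Rank1Residual.Typed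
  Summit.BirchSwinnertonDyer.Rank1Residual
  Summit.BirchSwinnertonDyer.Rank1Residual.P2
  Summit.BirchSwinnertonDyer.BirchSwinnertonDyer.Theorems.AddPotGoodPrint

namespace Summit.BirchSwinnertonDyer.BirchSwinnertonDyer.Theorems.GenusExact.TwinSwap.KrizLiAnchorWall

variable (V : WeierstrassCurve ℚ) [V.IsElliptic] [V.IsGloballyMinimal] [NeZero (V.conductorNorm ℤ)]

/-! ## §1 The road keyed on the additive wall row alone -/

/-- ★ **THE KRIZ–LI ANCHOR ROAD KEYED ON THE ADDITIVE WALL ROW — `BSD(W′, 2)` at every global minimal `W′ ≅ V^{(d)}` or `≅ V^{(d·d_K)}`, `d ∈ 𝒩(V, K)`,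
`χ_d(−N) = 1`**, from: `hAdd` (`BSD₂` for every non-CM global minimal curve of analytic rank `0` that is additive at `2` — WALL item 19098 unfolded),
`Addv V 2`, `0 ≤ ord₂ j(V)`, `d_K ≡ 1 (mod 4)`, `N(V) < 5000`, `¬CM(V)`, `r_an(V) = 1`, `V(ℚ)[2] = 0`, the Heegner field, the (★)-datum and Kriz–Li's local
clause (`c₂` odd AND — `V` being additive — `Dt.c` odd).  The companion is non-CM, of analytic rank `0`, additive at `2`.  BY NAME: Thm 5.1 (2), Thm 4.3,
Creutz–Miller.  CONDITIONAL on `hAdd`; BSD is not proved by any of this. [cite: KrizLi2019, Thm. 5.1 (2) and Thm. 4.3] [cite: CreutzMiller2012, Thm. 1.1]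
[cite: SilvermanAEC2009, VII.5 and X.5] -/
theorem krizLi_bsdp_two_of_twist_of_conductor_lt_of_addWall (hKL : KrizLi2019.thm112_bsdTwo_twist)
    (h33 : KrizLi2019.thm33_rank_twist) (hS31 : bsdTriple_of_analyticRank_le_one_of_conductor_lt)
    (hAdd : ∀ (W : WeierstrassCurve ℚ) [W.IsElliptic] [W.IsGloballyMinimal], ¬ W.HasCM → W.analyticRank = 0 →
      (haveI : Fact (Nat.Prime 2) := ⟨Nat.prime_two⟩; Addv W 2) → BSDp W 2)
    (hV : haveI : Fact (Nat.Prime 2) := ⟨Nat.prime_two⟩; Addv V 2) (hj : 0 ≤ padicValRat 2 V.j)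
    (hN : V.conductorNorm ℤ < 5000) (hcm : ¬ V.HasCM) (hr : V.analyticRank = 1)
    (h2 : ∀ Q : V.toAffine.Point, 2 • Q = 0 → Q = 0)
    (K : Type) [Field K] [NumberField K] (hK : IsImaginaryQuadratic K) (hdK4 : NumberField.discr K % 4 = 1)
    (hH : SatisfiesHeegnerHypothesis (V.conductorNorm ℤ) K)
    (Dt : ModularParametrizationData V (V.conductorNorm ℤ)) (H : HeegnerDatum (V.conductorNorm ℤ) (NumberField.discr K))
    (ι : K →+* ℂ) (P : (V.baseChange K).toAffine.Point) (hP : WeierstrassCurve.Affine.Point.map ι.toRatAlgHom P = heegnerPointComplex Dt H)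
    (j : K →ₐ[ℚ] ℚ_[2]) (hstar : KrizLi2019.AssumptionStar V Dt K P j)
    (hloc : (haveI : Fact (2 : ℕ).Prime := ⟨Nat.prime_two⟩;
      Odd ((V.baseChange ℚ_[2]).localTamagawaNumber ℤ_[2]) ∧
        (¬ V.HasGoodReductionAtPrime 2 → ¬ V.HasMultiplicativeReductionAtPrime 2 → Odd Dt.c)))
    {d : ℤ} (hd : KrizLi2019.InN V K d) (hsign : Int.sign d * jacobiSym (V.conductorNorm ℤ) d.natAbs = 1)
    (W' : WeierstrassCurve ℚ) [W'.IsElliptic] [W'.IsGloballyMinimal]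
    (hW' : (∃ C : VariableChange ℚ, C • V.quadraticTwist (d : ℚ) = W') ∨
      (∃ C : VariableChange ℚ, C • V.quadraticTwist ((d * NumberField.discr K : ℤ) : ℚ) = W')) :
    BSDp W' 2 := by
  have hD0 : NumberField.discr K ≠ 0 := NumberField.discr_ne_zero K
  have hD : (NumberField.discr K : ℚ) ≠ 0 := by exact_mod_cast hD0
  obtain ⟨W₀, _, _, hW₀⟩ := exists_globallyMinimal_twist V hD
  have hr0 : W₀.analyticRank = 0 :=
    krizLi_analyticRank_partner_eq_zero_of_rankOne V h33 h2 K hK hH Dt H ι P hP j hstar hr W₀ hW₀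
  have hcm0 : ¬ W₀.HasCM := not_hasCM_of_smul_quadraticTwist V hcm hD W₀ hW₀
  have hadd0 := (addv_two_of_smul_quadraticTwist_of_emod_four_eq_one V hV hj hdK4 hD0 W₀ hW₀).1
  exact krizLi_bsdp_two_of_twist_of_conductor_lt_of_partner_bsdp V hKL h33 hS31 hN h2 K hK hH Dt H ι P hP j hstar hloc W₀ hW₀
    (hAdd W₀ hcm0 hr0 hadd0) hd hsign W' hW'

/-! ## §2 The U₂-keyed sorting under the additive wall row -/

/-- **THE RANK-ONE MEMBERS `V^{(d)}` modulo the ADDITIVE wall row + PRINT + the anchor's (★)**: at every global minimal `W₁ ≅ V^{(d)}` (`d ∈ 𝒩(V, K)`,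
`χ_d(−N) = 1`): `r_an(W₁) = 1 ∧ ¬CM ∧ BSD(W₁, 2)`.  BSD is not proved by any of this; U₂ is not proved.
[cite: KrizLi2019, Thm. 5.1 (2), Thm. 4.3] [cite: CreutzMiller2012, Thm. 1.1] -/
theorem rankOneMembers_of_addWall (hKL : KrizLi2019.thm112_bsdTwo_twist)
    (h33 : KrizLi2019.thm33_rank_twist) (hS31 : bsdTriple_of_analyticRank_le_one_of_conductor_lt)
    (hAdd : ∀ (W : WeierstrassCurve ℚ) [W.IsElliptic] [W.IsGloballyMinimal], ¬ W.HasCM → W.analyticRank = 0 →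
      (haveI : Fact (Nat.Prime 2) := ⟨Nat.prime_two⟩; Addv W 2) → BSDp W 2)
    (hV : haveI : Fact (Nat.Prime 2) := ⟨Nat.prime_two⟩; Addv V 2) (hj : 0 ≤ padicValRat 2 V.j)
    (hN : V.conductorNorm ℤ < 5000) (hcm : ¬ V.HasCM) (hr : V.analyticRank = 1)
    (h2 : ∀ Q : V.toAffine.Point, 2 • Q = 0 → Q = 0)
    (K : Type) [Field K] [NumberField K] (hK : IsImaginaryQuadratic K) (hdK4 : NumberField.discr K % 4 = 1)
    (hH : SatisfiesHeegnerHypothesis (V.conductorNorm ℤ) K)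
    (Dt : ModularParametrizationData V (V.conductorNorm ℤ)) (H : HeegnerDatum (V.conductorNorm ℤ) (NumberField.discr K))
    (ι : K →+* ℂ) (P : (V.baseChange K).toAffine.Point) (hP : WeierstrassCurve.Affine.Point.map ι.toRatAlgHom P = heegnerPointComplex Dt H)
    (j : K →ₐ[ℚ] ℚ_[2]) (hstar : KrizLi2019.AssumptionStar V Dt K P j)
    (hloc : (haveI : Fact (2 : ℕ).Prime := ⟨Nat.prime_two⟩;
      Odd ((V.baseChange ℚ_[2]).localTamagawaNumber ℤ_[2]) ∧
        (¬ V.HasGoodReductionAtPrime 2 → ¬ V.HasMultiplicativeReductionAtPrime 2 → Odd Dt.c)))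
    {d : ℤ} (hd : KrizLi2019.InN V K d) (hsign : Int.sign d * jacobiSym (V.conductorNorm ℤ) d.natAbs = 1)
    (W₁ : WeierstrassCurve ℚ) [W₁.IsElliptic] [W₁.IsGloballyMinimal]
    (hW₁ : ∃ C : VariableChange ℚ, C • V.quadraticTwist (d : ℚ) = W₁) :
    W₁.analyticRank = 1 ∧ ¬ W₁.HasCM ∧ BSDp W₁ 2 := by
  have hB : BSDp W₁ 2 := krizLi_bsdp_two_of_twist_of_conductor_lt_of_addWall V hKL h33 hS31 hAdd hV hj hN hcm hr h2 K hK hdK4 hH Dt H ι P hP j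
    hstar hloc hd hsign W₁ (Or.inl hW₁)
  have hD : (NumberField.discr K : ℚ) ≠ 0 := by exact_mod_cast NumberField.discr_ne_zero K
  have hd0 : (d : ℚ) ≠ 0 := cast_ne_zero_of_inN V hd
  have hdK0 : ((d * NumberField.discr K : ℤ) : ℚ) ≠ 0 := by push_cast; exact mul_ne_zero hd0 hD
  obtain ⟨W₂, _, _, hW₂⟩ := exists_globallyMinimal_twist V hdK0
  obtain ⟨-, heq⟩ := krizLi_analyticRank_twists V h33 h2 K hK hH Dt H ι P hP j hstar hd hsign W₁ W₂ hW₁ hW₂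
  exact ⟨by rw [heq, hr], not_hasCM_of_smul_quadraticTwist V hcm hd0 W₁ hW₁, hB⟩

/-- **THE RANK-ZERO COMPANIONS `V^{(d·d_K)}` under the additive wall row**: at every global minimal `W₂ ≅ V^{(d·d_K)}` (`d ∈ 𝒩(V, K)`, `χ_d(−N) = 1`):
`r_an(W₂) = 0 ∧ ¬CM ∧ Addv W₂ 2 ∧ BSD(W₂, 2)` — members of EXACTLY the class item 19098 quantifies over.  BSD is not proved by any of this.
[cite: KrizLi2019, Thm. 5.1 (2), Thm. 4.3] [cite: CreutzMiller2012, Thm. 1.1] [cite: SilvermanAEC2009, VII.5 and X.5] -/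
theorem rankZeroCompanions_of_addWall (hKL : KrizLi2019.thm112_bsdTwo_twist)
    (h33 : KrizLi2019.thm33_rank_twist) (hS31 : bsdTriple_of_analyticRank_le_one_of_conductor_lt)
    (hAdd : ∀ (W : WeierstrassCurve ℚ) [W.IsElliptic] [W.IsGloballyMinimal], ¬ W.HasCM → W.analyticRank = 0 →
      (haveI : Fact (Nat.Prime 2) := ⟨Nat.prime_two⟩; Addv W 2) → BSDp W 2)
    (hV : haveI : Fact (Nat.Prime 2) := ⟨Nat.prime_two⟩; Addv V 2) (hj : 0 ≤ padicValRat 2 V.j)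
    (hN : V.conductorNorm ℤ < 5000) (hcm : ¬ V.HasCM) (hr : V.analyticRank = 1)
    (h2 : ∀ Q : V.toAffine.Point, 2 • Q = 0 → Q = 0)
    (K : Type) [Field K] [NumberField K] (hK : IsImaginaryQuadratic K) (hdK4 : NumberField.discr K % 4 = 1)
    (hH : SatisfiesHeegnerHypothesis (V.conductorNorm ℤ) K)
    (Dt : ModularParametrizationData V (V.conductorNorm ℤ)) (H : HeegnerDatum (V.conductorNorm ℤ) (NumberField.discr K))
    (ι : K →+* ℂ) (P : (V.baseChange K).toAffine.Point) (hP : WeierstrassCurve.Affine.Point.map ι.toRatAlgHom P = heegnerPointComplex Dt H)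
    (j : K →ₐ[ℚ] ℚ_[2]) (hstar : KrizLi2019.AssumptionStar V Dt K P j)
    (hloc : (haveI : Fact (2 : ℕ).Prime := ⟨Nat.prime_two⟩;
      Odd ((V.baseChange ℚ_[2]).localTamagawaNumber ℤ_[2]) ∧
        (¬ V.HasGoodReductionAtPrime 2 → ¬ V.HasMultiplicativeReductionAtPrime 2 → Odd Dt.c)))
    {d : ℤ} (hd : KrizLi2019.InN V K d) (hsign : Int.sign d * jacobiSym (V.conductorNorm ℤ) d.natAbs = 1)
    (W₂ : WeierstrassCurve ℚ) [W₂.IsElliptic] [W₂.IsGloballyMinimal]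
    (hW₂ : ∃ C : VariableChange ℚ, C • V.quadraticTwist ((d * NumberField.discr K : ℤ) : ℚ) = W₂) :
    haveI : Fact (Nat.Prime 2) := ⟨Nat.prime_two⟩
    W₂.analyticRank = 0 ∧ ¬ W₂.HasCM ∧ Addv W₂ 2 ∧ BSDp W₂ 2 := by
  have hB : BSDp W₂ 2 := krizLi_bsdp_two_of_twist_of_conductor_lt_of_addWall V hKL h33 hS31 hAdd hV hj hN hcm hr h2 K hK hdK4 hH Dt H ι P hP j
    hstar hloc hd hsign W₂ (Or.inr hW₂)
  have hD : (NumberField.discr K : ℚ) ≠ 0 := by exact_mod_cast NumberField.discr_ne_zero K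
  have hd0 : (d : ℚ) ≠ 0 := cast_ne_zero_of_inN V hd
  have hdK0 : ((d * NumberField.discr K : ℤ) : ℚ) ≠ 0 := by push_cast; exact mul_ne_zero hd0 hD
  obtain ⟨W₁, _, _, hW₁⟩ := exists_globallyMinimal_twist V hd0
  obtain ⟨hor, heq⟩ := krizLi_analyticRank_twists V h33 h2 K hK hH Dt H ι P hP j hstar hd hsign W₁ W₂ hW₁ hW₂
  have hr2 : W₂.analyticRank = 0 := by omega
  have hdd4 : (d * NumberField.discr K) % 4 = 1 := by rw [Int.mul_emod, hd.1, hdK4]; decide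
  have hdd0 : d * NumberField.discr K ≠ 0 := mul_ne_zero (by exact_mod_cast cast_ne_zero_of_inN V hd) (NumberField.discr_ne_zero K)
  have hadd2 := (addv_two_of_smul_quadraticTwist_of_emod_four_eq_one V hV hj hdd4 hdd0 W₂ hW₂).1
  exact ⟨hr2, not_hasCM_of_smul_quadraticTwist V hcm hdK0 W₂ hW₂, hadd2, hB⟩

end Summit.BirchSwinnertonDyer.BirchSwinnertonDyer.Theorems.GenusExact.TwinSwap.KrizLiAnchorWall

end
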